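import Literature.NumberTheory.IwasawaTheory.ClassicalMuVanishesCartanImageThreeQuadratic
import Literature.NumberTheory.EllipticCurves.FineSelmerClassGroupCriterionThm34Proofs
import HarnessLib

set_option autoImplicit false

/-!
# Statement (A) at `p = 3` on the Cartan-normaliser rows with NO named fact: from `μ(ℚ(P)) = 0` and `μ = 0` for the quadratic
# subfields of `ℚ(E[3])` not contained in `ℚ(P)` (Ferrero–Washington REMOVED)

Topic `NumberTheory/EllipticCurves`; THEOREM-ONLY file (no definition, no named fact, no `sorry`), written by the prover seat
`bsd-potss-k8t-c4` g23 (cell `bsd-potss`; supports the K9 / KT fine-Selmer residue cruxes stmt-BirchSwinnertonDyer-19942 / 19916 and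
the U₀ parents 19197 / 19982; closes nothing).  Twins of the (A)-doors of `FineSelmerMuRoadCartanImageThreeNoGrowth` (g22: `hCS`
discharged, `hI` removed, `hFW` displayed) with the LAST named fact `hFW : ferreroWashington1979_classicalMuVanishes` REMOVED: by the
character count of `ClassicalMuVanishesCartanQuadraticDescent` (g23) Ferrero–Washington entered only through the biquadratic subfield
`ℚ(√−3, √d)` of `ℚ(E[3])` and a quadratic field inside `ℚ(P)`, and is replaced by «`μ = 0` for every cyclotomic `ℤ_3`-extension of every
QUADRATIC subfield `K ⊆ ℚ(E[3])` with `K ⊄ ℚ(P)`» (for `τ` a complex conjugation: the two imaginary quadratic subfields), an input a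
finite class-group computation certifies (Iwasawa 1956 / Fukuda 1994, tree theorems).  Composition: Coates–Sujatha Thm. 3.4
(`thm34_…_holds`) ∘ `classicalMuVanishes_divisionField_of_{hasSplitCartanNormalizerModPImage,hasModPImageEqNonsplitCartanNormalizer}_three_of_quadratic`.

References: [CoatesSujatha2005] Thm. 3.4; [Washington1997] §13.1, §13.3; [Serre1972] §2.2; [BiasseEtAl2022] Example 2.5, Prop. 3.7.
-/

noncomputable section

open scoped NumberField

open Field IntermediateField WeierstrassCurve Literature.NumberTheory.EllipticCurves Literature.NumberTheory.GaloisRepresentations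
  Literature.NumberTheory.SerreUniformity Literature.NumberTheory.IwasawaTheory

namespace Literature.NumberTheory.EllipticCurves.CoatesSujatha2005

/-- **Statement (A) at `3` for a split-Cartan-normaliser image (`3Ns`), NO named fact**: `HasSplitCartanNormalizerModPImage E 3`,
`τ ∈ Γ_ℚ` an involution `≠ 1, −1` on `E[3]`, `μ = 0` (growth form) for every cyclotomic `ℤ_3`-extension of the fixed field of
`τ|_{ℚ(E[3])}` (`= ℚ(P)`) and of every quadratic subfield of `ℚ(E[3])` not contained in it; then the dual fine Selmer group of `E` over
`ℚ_cyc` is finitely generated over `ℤ_3`. [cite: CoatesSujatha2005, Thm. 3.4 (§3)] [cite: Washington1997, §13.1, §13.3 Prop. 13.23]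
[cite: Serre1972, §2.2 (split Cartan subgroups, normalisers)] -/
theorem fineSelmerDual_moduleFinite_of_hasSplitCartanNormalizerModPImage_three_of_quadratic
    (W : WeierstrassCurve ℚ) [W.IsElliptic]
    (himg : HasSplitCartanNormalizerModPImage W 3) (τ : absoluteGaloisGroup ℚ)
    (hτ2 : ∀ T : W.geomTorsion (3 : ℕ), τ • (τ • T) = T) (hτ1 : ∃ T : W.geomTorsion (3 : ℕ), τ • T ≠ T)
    (hτm : ∃ T : W.geomTorsion (3 : ℕ), τ • T ≠ -T)
    (hμ : ∀ κE : ZpExtension ↥(fixedField (Subgroup.zpowers (absRestrictNormalHom (W.divisionField 3) τ))) 3,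
      κE.IsCyclotomic → ClassicalMuVanishes κE)
    (hquad : ∀ K : IntermediateField ℚ ↥(W.divisionField 3), Module.finrank ℚ ↥K = 2 →
      ¬ K ≤ fixedField (Subgroup.zpowers (absRestrictNormalHom (W.divisionField 3) τ)) →
      ∀ κE : ZpExtension ↥K 3, κE.IsCyclotomic → ClassicalMuVanishes κE)
    (κ : ZpExtension ℚ 3) (hκ : κ.IsCyclotomic) :
    ∃ (γ : absoluteGaloisGroup ℚ) (D : W.FineSelmerDualData κ γ), Module.Finite ℤ_[3] (RestrictScalars ℤ_[3] (IwasawaAlgebra 3) D.X) :=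
  thm34_fineSelmerDual_moduleFinite_of_classicalMuVanishes_divisionField_holds W 3 (by decide)
    (classicalMuVanishes_divisionField_of_hasSplitCartanNormalizerModPImage_three_of_quadratic W himg τ hτ2 hτ1 hτm hμ hquad) κ hκ

/-- **Statement (A) at `3` for image equal to a non-split Cartan normaliser (`3Nn`), NO named fact**: as above with
`HasModPImageEqNonsplitCartanNormalizer E 3` (`ℚ(P)` of degree `8`). [cite: CoatesSujatha2005, Thm. 3.4 (§3)]
[cite: Washington1997, §13.1, §13.3 Prop. 13.23] [cite: Serre1972, §2.2 (non-split Cartan subgroups and their normalisers)] -/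
theorem fineSelmerDual_moduleFinite_of_hasModPImageEqNonsplitCartanNormalizer_three_of_quadratic
    (W : WeierstrassCurve ℚ) [W.IsElliptic]
    (himg : HasModPImageEqNonsplitCartanNormalizer W 3) (τ : absoluteGaloisGroup ℚ)
    (hτ2 : ∀ T : W.geomTorsion (3 : ℕ), τ • (τ • T) = T) (hτ1 : ∃ T : W.geomTorsion (3 : ℕ), τ • T ≠ T)
    (hτm : ∃ T : W.geomTorsion (3 : ℕ), τ • T ≠ -T)
    (hμ : ∀ κE : ZpExtension ↥(fixedField (Subgroup.zpowers (absRestrictNormalHom (W.divisionField 3) τ))) 3,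
      κE.IsCyclotomic → ClassicalMuVanishes κE)
    (hquad : ∀ K : IntermediateField ℚ ↥(W.divisionField 3), Module.finrank ℚ ↥K = 2 →
      ¬ K ≤ fixedField (Subgroup.zpowers (absRestrictNormalHom (W.divisionField 3) τ)) →
      ∀ κE : ZpExtension ↥K 3, κE.IsCyclotomic → ClassicalMuVanishes κE)
    (κ : ZpExtension ℚ 3) (hκ : κ.IsCyclotomic) :
    ∃ (γ : absoluteGaloisGroup ℚ) (D : W.FineSelmerDualData κ γ), Module.Finite ℤ_[3] (RestrictScalars ℤ_[3] (IwasawaAlgebra 3) D.X) :=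
  thm34_fineSelmerDual_moduleFinite_of_classicalMuVanishes_divisionField_holds W 3 (by decide)
    (classicalMuVanishes_divisionField_of_hasModPImageEqNonsplitCartanNormalizer_three_of_quadratic W himg τ hτ2 hτ1 hτm hμ hquad)
    κ hκ

end Literature.NumberTheory.EllipticCurves.CoatesSujatha2005

end
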